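import Literature.Analysis.FluidPDE.ESSLocalHolderConcentration
import Literature.Analysis.FluidPDE.NSCylinderVelocityCompactness
import Literature.Analysis.FluidPDE.L3WeakCompactness
import HarnessLib

/-!
# ESS Thm. 1.4 (`ess_local_holder`): the weak trace of the velocity at the apex time
# (ESS 2003, §3 (3.13); Seregin 2014, §6.6, (6.6.2)–(6.6.3): "`v(·,0) ∈ L₃(B(2/3))`")

Analysis/FluidPDE proofs-only file (theorems only: no definitions, no named facts) in the
bottom-up discharge of `Literature.Analysis.FluidPDE.ess_local_holder` (L. Escauriaza,
G. Seregin, V. Šverák, Russ. Math. Surveys 58:2 (2003) 211–250, Thm. 1.4). In the blow-up argument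
of ESS §3 / G. Seregin, *Lecture Notes on Regularity Theory for the Navier–Stokes Equations*
(2014), §6.6 the rescaled velocities inherit from the original pair the vanishing of the limit at
the final time, `u(·, 0) = 0` ((6.6.3)), through the value of `v` **at the apex time** `t₀`:
"we can show further that `v(·,0) ∈ L₃(B(2/3))`, which in turn implies (6.6.2)" (Seregin 2014,
p. 129). For the a.e.-defined field `v` this value is the weak trace: the pairings
`t ↦ ∫_{B(x₀,1/2)} ⟪v(t), θ⟫` with test fields `θ` are absolutely continuous up to `t₀` (the
momentum equation tested with `χ(t) θ(x)`, the tree's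
`NSCylinder.exists_ae_pairing_eq_const_add_primitive`), and their limits at `t₀` are the
pairings of one function `v̂ ∈ L³` (weak compactness in `L³` of the slices `v(t_k)`,
`‖v(t_k)‖_{L³(B(x₀,1/2))}³ ≤ M`, along good times `t_k ↑ t₀`; the tree's
`exists_strictMono_tendsto_integral_inner_of_eLpNorm_three_le`). This file proves exactly this,
for a countable family of test fields (which is all the blow-up argument needs, and avoids the
identification of the full weak trace):

* `exists_mem_fullMeasure_near_top` — a full-measure subset of `]a, b[` has points in every
  `]b - τ, b[`;
* `exists_apex_trace` — for a pair with (1.15)–(1.16) on `Q(1)`, `z₀ = (t₀, x₀) ∈ Q̄(1/2)` and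
  test fields `θ_j`, `j ∈ ℕ`, on `B(x₀, 1/2)`: there is `v̂ ∈ L³(ℝ³)` such that for every `j`
  and `ε > 0`, `|∫_{B(x₀,1/2)} ⟪v(t), θ_j⟫ - ∫ ⟪v̂, θ_j⟫| ≤ ε` for a.e. `t ∈ ]t₀ - τ, t₀[`, some
  `τ > 0`.

Nothing accepted is restated or changed; no `sorry`.

## References

* L. Escauriaza, G. Seregin, V. Šverák, Russ. Math. Surveys 58:2 (2003) 211–250: §3 (3.13).
  [`EscauriazaSereginSverak2003`]
* G. Seregin, *Lecture Notes on Regularity Theory for the Navier–Stokes Equations*, World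
  Scientific (2014), §6.6, (6.6.2)–(6.6.3), p. 127 and p. 129. [`Seregin2014`]
* R. Temam, *Navier–Stokes equations*, North-Holland (1977/79), Ch. III, §3, (3.40)–(3.43)
  (weak time continuity of the pairings). [`Temam1979`]
-/

noncomputable section

open MeasureTheory Set Function Filter Topology TopologicalSpace Metric
open scoped NNReal ENNReal InnerProductSpace RealInnerProductSpace Laplacian

namespace Literature.Analysis.FluidPDE

/-! ### Full-measure sets reach the top of the interval -/

/-- A property holding for a.e. `t ∈ ]a, b[` holds at some point of every `]b - τ, b[`
(`a < b`, `τ > 0`). [folklore] -/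
theorem exists_mem_fullMeasure_near_top {a b : ℝ} (hab : a < b) {G : Set ℝ}
    (hG : ∀ᵐ t ∂(volume.restrict (Ioo a b)), t ∈ G) {τ : ℝ} (hτ : 0 < τ) :
    ∃ t ∈ G, a < t ∧ b - τ < t ∧ t < b := by
  by_contra hne
  push Not at hne
  set I : Set ℝ := Ioo (max a (b - τ)) b with hI
  have hIsub : I ⊆ Ioo a b := Ioo_subset_Ioo (le_max_left _ _) le_rfl
  have hInull : volume I = 0 := by
    have h1 : ∀ᵐ t ∂(volume.restrict I), t ∈ G := ae_restrict_of_ae_restrict_of_subset hIsub hG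
    have h2 : ∀ᵐ t ∂(volume.restrict I), False := by
      filter_upwards [h1, ae_restrict_mem measurableSet_Ioo] with t ht htI
      exact (hne t ht ((le_max_left _ _).trans_lt htI.1)
        ((le_max_right _ _).trans_lt htI.1)).not_gt htI.2
    have h3 : volume.restrict I = 0 := Measure.measure_univ_eq_zero.1 (by
      simpa using (ae_iff.1 h2))
    have := Measure.restrict_eq_zero.1 h3
    exact this
  have hIpos : 0 < volume I := by
    rw [hI, Real.volume_Ioo]
    exact ENNReal.ofReal_pos.2 (by
      have : max a (b - τ) < b := max_lt hab (by linarith)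
      linarith)
  exact hIpos.ne' hInull

/-! ### The weak trace at the apex -/

section ApexTrace

variable {v : ℝ → EuclideanSpace ℝ (Fin 3) → EuclideanSpace ℝ (Fin 3)}
  {p : ℝ → EuclideanSpace ℝ (Fin 3) → ℝ}

/-- The pairing of an indicator with a field equals the pairing over the set. [folklore] -/
theorem integral_inner_indicator_eq {s : Set (EuclideanSpace ℝ (Fin 3))} (hs : MeasurableSet s)
    (f θ : EuclideanSpace ℝ (Fin 3) → EuclideanSpace ℝ (Fin 3)) :
    ∫ x, ⟪s.indicator f x, θ x⟫ = ∫ x in s, ⟪f x, θ x⟫ := by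
  rw [← integral_indicator hs]
  refine integral_congr_ae (Eventually.of_forall fun x => ?_)
  by_cases hx : x ∈ s
  · simp [indicator_of_mem hx]
  · simp [indicator_of_notMem hx]

/-- **The weak trace of the velocity at the apex time, along a countable family of test fields**
(ESS 2003, §3 (3.13); Seregin 2014, §6.6, the step "`v(·,0) ∈ L₃`" behind (6.6.2)–(6.6.3);
Temam 1977/79, Ch. III §3 for the weak time continuity). Let `(v, p)` satisfy (1.15)–(1.16) on
`Q(1)`, let `z₀ = (t₀, x₀) ∈ Q̄(1/2)`, and let `θ_j`, `j ∈ ℕ`, be test fields on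
`B(x₀, 1/2)`. Then there is `v̂ ∈ L³(ℝ³)` such that for every `j` and every `ε > 0` there is
`τ > 0` with `|∫_{B(x₀,1/2)} ⟪v(t), θ_j⟫ - ∫ ⟪v̂, θ_j⟫| ≤ ε` for a.e. `t ∈ ]t₀ - τ, t₀[`. Proof:
on the cylinder `]t₀ - 1/4, t₀[ × B(x₀, 1/2) ⊆ Q(1)` each pairing is a.e. a primitive
`c_j + ∫_{t₀-1/4}^t f_j` with `f_j ∈ L¹` (`NSCylinder.exists_ae_pairing_eq_const_add_primitive`),
hence has a limit `L_j` at `t₀`; along good times `t_k ↑ t₀` the slices `v(t_k) 1_{B}` are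
bounded in `L³` by the sliced bound (1.16), so a subsequence converges weakly to some `v̂ ∈ L³`
(`exists_strictMono_tendsto_integral_inner_of_eLpNorm_three_le`), and `L_j = ∫ ⟪v̂, θ_j⟫`. [cite: EscauriazaSereginSverak2003, §3 (3.13)] [cite: Seregin2014, §6.6 p. 127 and p. 129] -/
theorem exists_apex_trace
    (h : IsL3inftyLocalPair 1 1 ((0 : ℝ), (0 : EuclideanSpace ℝ (Fin 3))) v p)
    {z₀ : ℝ × EuclideanSpace ℝ (Fin 3)}
    (hz₀ : z₀ ∈ closure (parabolicCylinder (1 / 2) ((0 : ℝ), (0 : EuclideanSpace ℝ (Fin 3)))))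
    (θ : ℕ → EuclideanSpace ℝ (Fin 3) → EuclideanSpace ℝ (Fin 3))
    (hθ : ∀ j, FunctionSpaces.IsTestFunctionOn
      (⟨ball z₀.2 (1 / 2), isOpen_ball⟩ : Opens (EuclideanSpace ℝ (Fin 3))) (θ j)) :
    ∃ vh : EuclideanSpace ℝ (Fin 3) → EuclideanSpace ℝ (Fin 3), MemLp vh 3 volume ∧
      ∀ j : ℕ, ∀ ε : ℝ, 0 < ε → ∃ τ : ℝ, 0 < τ ∧
        ∀ᵐ t ∂(volume.restrict (Ioo (z₀.1 - τ) z₀.1)),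
          |(∫ x in ball z₀.2 (1 / 2), ⟪v t x, θ j x⟫) - ∫ x, ⟪vh x, θ j x⟫| ≤ ε := by
  classical
  -- ## the cylinder `]t₀ - 1/4, t₀[ × B(x₀, 1/2) ⊆ Q(1)`
  set Ω : Opens (EuclideanSpace ℝ (Fin 3)) := ⟨ball z₀.2 (1 / 2), isOpen_ball⟩ with hΩdef
  set a : ℝ := z₀.1 - (1 / 2) ^ 2 with ha
  set b : ℝ := z₀.1 with hb
  have hab : a < b := by rw [ha, hb]; norm_num
  have hΩset : ((Ω : Opens (EuclideanSpace ℝ (Fin 3))) : Set (EuclideanSpace ℝ (Fin 3))) =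
      ball z₀.2 (1 / 2) := rfl
  have hbΩ : Bornology.IsBounded ((Ω : Opens (EuclideanSpace ℝ (Fin 3))) :
      Set (EuclideanSpace ℝ (Fin 3))) := by rw [hΩset]; exact isBounded_ball
  have hcyl_set : Ioo a b ×ˢ ((Ω : Opens (EuclideanSpace ℝ (Fin 3))) :
      Set (EuclideanSpace ℝ (Fin 3))) = parabolicCylinder (1 / 2) z₀ := rfl
  have hsubQ : parabolicCylinder (1 / 2) z₀ ⊆
      parabolicCylinder 1 ((0 : ℝ), (0 : EuclideanSpace ℝ (Fin 3))) :=
    parabolicCylinder_subset_unit_of_mem_closure_half hz₀ (by norm_num) le_rfl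
  have hle : timeCylinder Ω a b ≤ parabolicCylinderOpens 1 ((0 : ℝ), (0 : EuclideanSpace ℝ (Fin 3))) := by
    intro w hw
    exact hsubQ (by rw [← hcyl_set]; exact hw)
  obtain ⟨hI, hB⟩ := intervals_subset_of_mem_closure_half hz₀ (by norm_num : (0 : ℝ) ≤ 1 / 2) le_rfl
  obtain ⟨h1, ⟨C₂, h2⟩, -, h4, ⟨C₃, h5⟩⟩ := IsL3inftyLocalPair.unit_iff.1 h
  have hsol : IsDistributionalNSSolutionOn (timeCylinder Ω a b) 1 0 v p := h1.of_le hle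
  have hm : AEStronglyMeasurable (uncurry v)
      (volume.restrict (Ioo a b ×ˢ ((Ω : Opens (EuclideanSpace ℝ (Fin 3))) :
        Set (EuclideanSpace ℝ (Fin 3))))) := hsol.1.aestronglyMeasurable
  have hpm : AEStronglyMeasurable (uncurry p)
      (volume.restrict (Ioo a b ×ˢ ((Ω : Opens (EuclideanSpace ℝ (Fin 3))) :
        Set (EuclideanSpace ℝ (Fin 3))))) := hsol.2.2.1.aestronglyMeasurable
  -- sliced bounds on the cylinder
  have hE2 : ∀ᵐ t ∂(volume.restrict (Ioo a b)),
      ∫⁻ x in ((Ω : Opens (EuclideanSpace ℝ (Fin 3))) : Set (EuclideanSpace ℝ (Fin 3))),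
        ‖v t x‖ₑ ^ 2 ≤ C₂ := by
    filter_upwards [ae_restrict_of_ae_restrict_of_subset hI h2] with t ht
    exact (lintegral_mono_set hB).trans ht
  have hE3 : ∀ᵐ t ∂(volume.restrict (Ioo a b)),
      ∫⁻ x in ((Ω : Opens (EuclideanSpace ℝ (Fin 3))) : Set (EuclideanSpace ℝ (Fin 3))),
        ‖v t x‖ₑ ^ 3 ≤ C₃ := by
    filter_upwards [ae_restrict_of_ae_restrict_of_subset hI h5] with t ht
    exact (lintegral_mono_set hB).trans ht
  have hu2 : ∫⁻ z in Ioo a b ×ˢ ((Ω : Opens (EuclideanSpace ℝ (Fin 3))) :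
      Set (EuclideanSpace ℝ (Fin 3))), ‖v z.1 z.2‖ₑ ^ 2 < ∞ := by
    have h6 : ∫⁻ z in Ioo a b ×ˢ ((Ω : Opens (EuclideanSpace ℝ (Fin 3))) :
        Set (EuclideanSpace ℝ (Fin 3))), ‖uncurry v z‖ₑ ^ 2 ≤ C₂ * volume (Ioo a b) :=
      setLIntegral_prod_le_of_slice_bound hE2
    refine lt_of_le_of_lt h6 (ENNReal.mul_lt_top ENNReal.coe_lt_top ?_)
    rw [Real.volume_Ioo]; exact ENNReal.ofReal_lt_top
  have hPfin : ∫⁻ z in Ioo a b ×ˢ ((Ω : Opens (EuclideanSpace ℝ (Fin 3))) :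
      Set (EuclideanSpace ℝ (Fin 3))), ‖p z.1 z.2‖ₑ ^ (3 / 2 : ℝ) < ∞ := by
    rw [hcyl_set]
    exact lt_of_le_of_lt (lintegral_mono_set hsubQ) h4
  have hpi := NSCylinder.integrable_pressure_of_lintegral_rpow hbΩ hpm hPfin
  have hu := NSCylinder.integrable_of_lintegral_sq hbΩ hm hu2
  have hu2' := NSCylinder.integrable_norm_sq_of_lintegral_sq hm hu2
  -- ## the remainders `f_j` and the primitives
  set f : ℕ → ℝ → ℝ := fun j s => ∫ x in ((Ω : Opens (EuclideanSpace ℝ (Fin 3))) :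
      Set (EuclideanSpace ℝ (Fin 3))),
    (⟪v s x, fderiv ℝ (θ j) x (v s x)⟫ + ⟪v s x, Δ (θ j) x⟫ +
      p s x * VectorCalculus.divergence (θ j) x) with hf
  have hfi : ∀ j, IntegrableOn (f j) (Ioo a b) volume := by
    intro j
    obtain ⟨K₀, K₁, K₂, -, hK₁, hK₂⟩ := exists_bounds_of_isTestFunctionOn (hθ j)
    have hη2 : ContDiff ℝ 2 (θ j) := (hθ j).contDiff.of_le (by norm_cast)
    have iG := NSCylinder.integrable_remainder_test hu hu2' hpi hη2 hK₁ hK₂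
    rw [FunctionSpaces.AubinLions.volume_restrict_prod] at iG
    exact iG.integral_prod_left
  set P : ℕ → ℝ → ℝ := fun j t => ∫ x in ((Ω : Opens (EuclideanSpace ℝ (Fin 3))) :
      Set (EuclideanSpace ℝ (Fin 3))), ⟪v t x, θ j x⟫ with hP
  have hrep : ∀ j, ∃ c : ℝ, ∀ᵐ t ∂(volume.restrict (Ioo a b)),
      P j t = c + ∫ s in Ioc a t, f j s := fun j =>
    NSCylinder.exists_ae_pairing_eq_const_add_primitive hsol hbΩ hu2 hpi (hθ j)
  choose c hc using hrep
  -- the primitives `F_j(x) = ∫_a^x f_j` are continuous on `[a, b]`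
  set F : ℕ → ℝ → ℝ := fun j x => ∫ t in a..x, f j t with hF
  have hFcont : ∀ j, ContinuousOn (F j) (Icc a b) := by
    intro j
    have h0 : IntegrableOn (f j) (uIcc a b) volume := by
      rw [uIcc_of_le hab.le]
      exact (integrableOn_Icc_iff_integrableOn_Ioo enorm_ne_top enorm_ne_top).2 (hfi j)
    have := intervalIntegral.continuousOn_primitive_interval (μ := volume) h0
    rwa [uIcc_of_le hab.le] at this
  have hFIoc : ∀ j, ∀ x, a ≤ x → F j x = ∫ t in Ioc a x, f j t := fun j x hx =>
    intervalIntegral.integral_of_le hx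
  set L : ℕ → ℝ := fun j => c j + F j b with hL
  -- ## the pairing tends to `L_j` at the apex, a.e.
  have hconvL : ∀ j, ∀ ε : ℝ, 0 < ε → ∃ τ : ℝ, 0 < τ ∧
      ∀ᵐ t ∂(volume.restrict (Ioo (b - τ) b)), |P j t - L j| ≤ ε := by
    intro j ε hε
    have hcb : ContinuousWithinAt (F j) (Icc a b) b := hFcont j b ⟨hab.le, le_rfl⟩
    rw [Metric.continuousWithinAt_iff] at hcb
    obtain ⟨τ₀, hτ₀, hτ⟩ := hcb ε hε
    set τ : ℝ := min τ₀ (b - a) with hτdef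
    have hτpos : 0 < τ := lt_min hτ₀ (by linarith)
    refine ⟨τ, hτpos, ?_⟩
    have hsub : Ioo (b - τ) b ⊆ Ioo a b :=
      Ioo_subset_Ioo (by have := min_le_right τ₀ (b - a); linarith) le_rfl
    filter_upwards [ae_restrict_of_ae_restrict_of_subset hsub (hc j),
      ae_restrict_mem measurableSet_Ioo] with t ht htI
    have htab : t ∈ Icc a b := ⟨(hsub htI).1.le, htI.2.le⟩
    have hdist : dist t b < τ₀ := by
      rw [Real.dist_eq, abs_sub_comm, abs_of_nonneg (by linarith [htI.2])]
      have := min_le_left τ₀ (b - a)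
      linarith [htI.1]
    have h1 := hτ htab hdist
    rw [ht, hL, ← hFIoc j t htab.1]
    rw [Real.dist_eq] at h1
    have e : c j + F j t - (c j + F j b) = F j t - F j b := by ring
    rw [e]
    exact h1.le
  -- ## good times and the weak limit of the slices
  have hμprod : (volume.restrict (Ioo a b ×ˢ ((Ω : Opens (EuclideanSpace ℝ (Fin 3))) :
      Set (EuclideanSpace ℝ (Fin 3)))) : Measure (ℝ × EuclideanSpace ℝ (Fin 3))) =
      (volume.restrict (Ioo a b)).prod (volume.restrict (ball z₀.2 (1 / 2))) := by
    rw [Measure.prod_restrict, ← Measure.volume_eq_prod]; rfl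
  have hslice : ∀ᵐ t ∂(volume.restrict (Ioo a b)),
      AEStronglyMeasurable (v t) (volume.restrict (ball z₀.2 (1 / 2))) := by
    have h0 := hm
    rw [hμprod] at h0
    filter_upwards [h0.prodMk_left] with t ht
    exact ht
  set G : Set ℝ := {t | (∀ j, P j t = c j + ∫ s in Ioc a t, f j s) ∧
    ∫⁻ x in ball z₀.2 (1 / 2), ‖v t x‖ₑ ^ 3 ≤ C₃ ∧
    AEStronglyMeasurable (v t) (volume.restrict (ball z₀.2 (1 / 2)))} with hGdef
  have hG : ∀ᵐ t ∂(volume.restrict (Ioo a b)), t ∈ G := by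
    have hall : ∀ᵐ t ∂(volume.restrict (Ioo a b)), ∀ j, P j t = c j + ∫ s in Ioc a t, f j s :=
      ae_all_iff.2 hc
    filter_upwards [hall, hE3, hslice] with t h1' h2' h3'
    exact ⟨h1', h2', h3'⟩
  have htk : ∀ k : ℕ, ∃ t ∈ G, a < t ∧ b - 1 / ((k : ℝ) + 1) < t ∧ t < b := fun k =>
    exists_mem_fullMeasure_near_top hab hG (by positivity)
  choose tk htkG htka htk1 htk2 using htk
  have htk_tendsto : Tendsto tk atTop (𝓝 b) := by
    have h0 : Tendsto (fun k : ℕ => b - 1 / ((k : ℝ) + 1)) atTop (𝓝 (b - 0)) :=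
      tendsto_const_nhds.sub tendsto_one_div_add_atTop_nhds_zero_nat
    rw [sub_zero] at h0
    exact tendsto_of_tendsto_of_tendsto_of_le_of_le h0 tendsto_const_nhds
      (fun k => (htk1 k).le) (fun k => (htk2 k).le)
  -- the slices as `L³(ℝ³)` functions
  set av : ℕ → EuclideanSpace ℝ (Fin 3) → EuclideanSpace ℝ (Fin 3) :=
    fun k => (ball z₀.2 (1 / 2)).indicator (v (tk k)) with hav
  have hav_mem : ∀ k, MemLp (av k) 3 volume := by
    intro k
    rw [hav, memLp_indicator_iff_restrict measurableSet_ball]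
    refine ⟨(htkG k).2.2, ?_⟩
    rw [eLpNorm_eq_lintegral_rpow_enorm_toReal (by norm_num) (by norm_num), ENNReal.toReal_ofNat]
    refine ENNReal.rpow_lt_top_of_nonneg (by norm_num) ?_
    have e : ∫⁻ x in ball z₀.2 (1 / 2), ‖v (tk k) x‖ₑ ^ (3 : ℝ) =
        ∫⁻ x in ball z₀.2 (1 / 2), ‖v (tk k) x‖ₑ ^ (3 : ℕ) :=
      lintegral_congr fun x => by rw [show (3 : ℝ) = ((3 : ℕ) : ℝ) by norm_num, ENNReal.rpow_natCast]
    rw [e]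
    exact ne_top_of_le_ne_top ENNReal.coe_ne_top (htkG k).2.1
  set M' : ℝ≥0 := C₃ ^ (1 / 3 : ℝ) with hM'
  have hav_bd : ∀ k, eLpNorm (av k) 3 volume ≤ M' := by
    intro k
    rw [hav, eLpNorm_indicator_eq_eLpNorm_restrict measurableSet_ball,
      eLpNorm_eq_lintegral_rpow_enorm_toReal (by norm_num) (by norm_num), ENNReal.toReal_ofNat,
      hM', ENNReal.coe_rpow_of_nonneg _ (by norm_num)]
    refine ENNReal.rpow_le_rpow ?_ (by norm_num)
    have e : ∫⁻ x in ball z₀.2 (1 / 2), ‖v (tk k) x‖ₑ ^ (3 : ℝ) =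
        ∫⁻ x in ball z₀.2 (1 / 2), ‖v (tk k) x‖ₑ ^ (3 : ℕ) :=
      lintegral_congr fun x => by rw [show (3 : ℝ) = ((3 : ℕ) : ℝ) by norm_num, ENNReal.rpow_natCast]
    rw [e]
    exact (htkG k).2.1
  obtain ⟨σ, vh, hσ, hvh, -, hweak⟩ :=
    exists_strictMono_tendsto_integral_inner_of_eLpNorm_three_le M' av hav_mem hav_bd
  -- ## identification of the limits: `L_j = ∫ ⟪v̂, θ_j⟫`
  have hLeq : ∀ j, L j = ∫ x, ⟪vh x, θ j x⟫ := by
    intro j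
    -- along `t_{σ k}`, the pairings converge both to `L_j` and to `∫ ⟪v̂, θ_j⟫`
    have h1' : Tendsto (fun k => P j (tk (σ k))) atTop (𝓝 (∫ x, ⟪vh x, θ j x⟫)) := by
      have h0 := hweak (θ j) (hθ j).contDiff.continuous (hθ j).hasCompactSupport
      refine (tendsto_congr fun k => ?_).1 h0
      rw [hav]
      exact integral_inner_indicator_eq measurableSet_ball _ _
    have h2' : Tendsto (fun k => P j (tk (σ k))) atTop (𝓝 (L j)) := by
      have e : ∀ k, P j (tk (σ k)) = c j + F j (tk (σ k)) := by
        intro k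
        rw [(htkG (σ k)).1 j, hFIoc j _ (htka (σ k)).le]
      simp_rw [e]
      have hcF : Tendsto (fun k => F j (tk (σ k))) atTop (𝓝 (F j b)) := by
        have hcb : ContinuousWithinAt (F j) (Icc a b) b := hFcont j b ⟨hab.le, le_rfl⟩
        refine hcb.tendsto.comp ?_
        refine tendsto_nhdsWithin_iff.2 ⟨htk_tendsto.comp hσ.tendsto_atTop,
          Eventually.of_forall fun k => ⟨(htka (σ k)).le, (htk2 (σ k)).le⟩⟩
      exact tendsto_const_nhds.add hcF
    exact tendsto_nhds_unique h2' h1'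
  -- ## conclusion
  refine ⟨vh, hvh, fun j ε hε => ?_⟩
  obtain ⟨τ, hτ, hconv⟩ := hconvL j ε hε
  refine ⟨τ, hτ, ?_⟩
  rw [← hLeq j]
  exact hconv

end ApexTrace

end Literature.Analysis.FluidPDE
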